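import Literature.Computability.Cryptography.Harvey2021
import HarnessLib

/-!
# Harvey's exponent one-fifth factoring algorithm: the mathematics of the main search (§4)

Continuation of `Harvey2021.lean` (D. Harvey, *An exponent one-fifth algorithm for deterministic
integer factorisation*, Math. Comp. **90** (2021), 2937–2950; key `Harvey2021`), collecting the
*proved* number-theoretic content of §4 (Algorithms 1–2, Props. 4.1–4.2 = arXiv Props. 14–15)
that a machine-level proof of Theorem 1.1 / **pqc.S09** (`harvey_factoring_one_fifth`) consumes:

* `prop42_witness` — the correctness certificate of the main search (proof of Prop. 4.2): under
  the hypotheses of Algorithm 2 (`N = pq`, `(N/r)^{1/2} ≤ p < N^{1/2}`, `m ≥ 1`, `α` a unit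
  modulo `p`) some baby step `α^i`, `i < m`, coincides in `ℤ/p` with some giant step
  `v_{a,b,j} = α^{-jm} α^{aN+b-⌈(4abN)^{1/2}⌉}`, `1 ≤ ab ≤ r`, `j < N^{1/2}/(4rm(ab)^{1/2})`, and
  the corresponding candidate `u = i + jm + ⌈(4abN)^{1/2}⌉` equals `aq + bp` — so Step (3)
  (exact match modulo `N`, then Lemma 3.1) or Step (4) (collision modulo `p`, Algorithm 1) finds
  `p` and `q`.  Assembled from Lemma 3.3 (`lemma33_lehman`) and the Fermat congruence
  (`pow_aq_add_bp`) exactly as printed;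
* `step1_detects`, `one_lt_gcd_lt` — Step (1) of Algorithm 2: if `ord_p(α) < m ≤ ord_N(α)` the
  gcd `gcd(N, α^{ord_p(α)} − 1)` is a nontrivial divisor of `N`;
* `candidate_count_le` (with `sum_Icc_one_div_sqrt_le`, `sum_Icc_div_le`,
  `sum_sum_one_div_sqrt_mul_le`) — the counting in the running-time analysis of
  Prop. 4.2: the number of pairs `(a, b)` with `ab ≤ r` is `≤ r(1 + log r)` and the number `s` of
  giant steps is `≤ ∑_{ab ≤ r} (X/(ab)^{1/2} + 1) ≤ (2X√r + r)(1 + log r)`, `X = N^{1/2}/(4rm)`.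

No named facts are introduced (D-0026); machine statements (running times) are not here.
-/

open Real Finset

namespace Literature.Computability.Cryptography

open Turing _root_.Computability

namespace Harvey2021

/-- **The witness behind the main search** (proof of **Prop. 4.2** = arXiv Prop. 15, the chain
from Lemma 3.3 to the displayed congruence `v_{a₀,b₀,j₀} ≡ α^{i₀} (mod p)`): let `p` be prime,
`N = pq` with `(N/r)^{1/2} ≤ p < N^{1/2}`, `m ≥ 1`, and `α ≠ 0` in `ℤ/p`.  Then there are
positive integers
`a, b` with `ab ≤ r`, and `i < m`, `j < N^{1/2}/(4 r m (ab)^{1/2})`, such that with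
`c = ⌈(4abN)^{1/2}⌉` (so `c ≤ aq + bp` and `c ≤ aN + b`) one has `i + jm + c = aq + bp` — the
candidate `u` examined in Step (3) — and the *baby-step = giant-step* relation
`α^i = α^{-jm} · t_{a,b}`, `t_{a,b} = α^{aN + b - c}`, in `ℤ/p` (the paper's `v_{a,b,j} ≡ α^{i}
(mod p)`).  Proof as printed: Lemma 3.3 gives `a, b` and `0 ≤ y := aq + bp − c <
N^{1/2}/(4r(ab)^{1/2})`; `α^{aq+bp} = α^{aN+b}` in `ℤ/p` (`pow_aq_add_bp`); write `y = i + jm`.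
[cite: Harvey2021, proof of Prop. 4.2 (arXiv Prop. 15)] -/
theorem prop42_witness {p : ℕ} [hp : Fact p.Prime] {N q r m : ℕ} (hq : 0 < q) (hr : 0 < r)
    (hm : 0 < m) (hN : N = p * q) (hlow : Real.sqrt (N / r) ≤ p) (hup : (p : ℝ) < Real.sqrt N)
    {α : ZMod p} (hα : α ≠ 0) :
    ∃ a b i j : ℕ, 0 < a ∧ 0 < b ∧ a * b ≤ r ∧ i < m ∧
      (j : ℝ) < Real.sqrt N / (4 * r * m * Real.sqrt (a * b)) ∧
      ⌈Real.sqrt (4 * (a * b) * N)⌉₊ ≤ a * q + b * p ∧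
      ⌈Real.sqrt (4 * (a * b) * N)⌉₊ ≤ a * N + b ∧
      i + j * m + ⌈Real.sqrt (4 * (a * b) * N)⌉₊ = a * q + b * p ∧
      α ^ i = (α ^ (j * m))⁻¹ * α ^ (a * N + b - ⌈Real.sqrt (4 * (a * b) * N)⌉₊) := by
  have hp0 : 0 < p := hp.out.pos
  obtain ⟨a, b, ha, hb, hab, h0, h1⟩ := lemma33_lehman hp0 hq hr hN hlow hup
  refine ⟨a, b, ?_⟩
  obtain ⟨c, hc⟩ : ∃ c : ℕ, c = ⌈Real.sqrt (4 * (a * b) * N)⌉₊ := ⟨_, rfl⟩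
  rw [← hc]
  -- `c ≤ u = aq + bp` and `c ≤ aN + b`
  have hcu : c ≤ a * q + b * p := by
    rw [hc, Nat.ceil_le]
    push_cast
    linarith [h0]
  have hcN : c ≤ a * N + b := by
    rw [hc, Nat.ceil_le]
    push_cast
    refine Real.sqrt_le_iff.2 ⟨by positivity, ?_⟩
    nlinarith [sq_nonneg ((a : ℝ) * N - b)]
  obtain ⟨y, hy⟩ : ∃ y : ℕ, y = a * q + b * p - c := ⟨_, rfl⟩
  refine ⟨y % m, y / m, ha, hb, hab, Nat.mod_lt _ hm, ?_, hcu, hcN, ?_, ?_⟩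
  · -- `j = ⌊y/m⌋ < N^{1/2} / (4 r m (ab)^{1/2})`
    have hyc : (y : ℝ) = a * q + b * p - c := by
      rw [hy, Nat.cast_sub hcu]
      push_cast
      ring
    have hcge : Real.sqrt (4 * (a * b) * N) ≤ c := by rw [hc]; exact Nat.le_ceil _
    have hy_lt : (y : ℝ) < Real.sqrt N / (4 * r * Real.sqrt (a * b)) := by
      rw [hyc]
      linarith [h1]
    have hm' : (0 : ℝ) < m := by exact_mod_cast hm
    calc ((y / m : ℕ) : ℝ) ≤ (y : ℝ) / m := Nat.cast_div_le
      _ < Real.sqrt N / (4 * r * Real.sqrt (a * b)) / m := div_lt_div_of_pos_right hy_lt hm'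
      _ = Real.sqrt N / (4 * r * m * Real.sqrt (a * b)) := by
          rw [div_div]
          congr 1
          ring
  · -- `i + jm + c = u`
    rw [Nat.mod_add_div', hy, Nat.sub_add_cancel hcu]
  · -- the congruence in `ℤ/p`
    have key : α ^ (a * q + b * p) = α ^ (a * N + b) := by
      rw [hN]
      exact pow_aq_add_bp q a b α
    have e1 : α ^ y * α ^ c = α ^ (a * N + b - c) * α ^ c := by
      rw [← pow_add, ← pow_add, Nat.sub_add_cancel hcN, hy, Nat.sub_add_cancel hcu, key]
    have e2 : α ^ y = α ^ (a * N + b - c) := mul_right_cancel₀ (pow_ne_zero _ hα) e1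
    have e3 : α ^ (y % m) * α ^ (y / m * m) = α ^ y := by rw [← pow_add, Nat.mod_add_div']
    rw [eq_inv_mul_iff_mul_eq₀ (pow_ne_zero _ hα), mul_comm, e3, e2]

/-- **Step (1) of Algorithm 2** (proof of **Prop. 4.2** = arXiv Prop. 15, first paragraph): if
`i = ord_p(α) < m ≤ ord_N(α)` (`p ∣ N`), then `α^i ≠ 1` in `ℤ/N` while `α^i = 1` in `ℤ/p`, so the
gcd `gcd(N, α^i − 1)` computed in Step (1) is a nontrivial divisor of `N` ("the hypothesis
`ord_N(α) ≥ m` ensures that `α^i ≠ 1` for this `i`").  Here `ord` is Mathlib's `orderOf`, and the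
reduction modulo `p` is `ZMod.castHom`. [cite: Harvey2021, proof of Prop. 4.2 (arXiv Prop. 15)] -/
theorem step1_detects {N p : ℕ} (hpN : p ∣ N) (α : ZMod N) {m : ℕ} (hm : m ≤ orderOf α)
    (hi0 : 0 < orderOf (ZMod.castHom hpN (ZMod p) α))
    (him : orderOf (ZMod.castHom hpN (ZMod p) α) < m) :
    α ^ orderOf (ZMod.castHom hpN (ZMod p) α) ≠ 1 ∧
      ZMod.castHom hpN (ZMod p) (α ^ orderOf (ZMod.castHom hpN (ZMod p) α)) = 1 := by
  refine ⟨pow_ne_one_of_lt_orderOf hi0.ne' (him.trans_le hm), ?_⟩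
  rw [map_pow, pow_orderOf_eq_one]

/-- The gcd taken in Step (1) (and in Steps (3b), (3ci) of Algorithm 1) is a nontrivial divisor:
if `p ∣ x`, `p ∣ N`, `1 < p` and `0 < x < N` (e.g. `x` the residue of `α^i − 1`, nonzero
modulo `N` and zero modulo `p`), then `1 < gcd(x, N) < N`. [folklore] -/
theorem one_lt_gcd_lt {N p x : ℕ} (hp : 1 < p) (hpN : p ∣ N) (hpx : p ∣ x) (hx0 : 0 < x)
    (hxN : x < N) : 1 < Nat.gcd x N ∧ Nat.gcd x N < N := by
  constructor
  · exact lt_of_lt_of_le hp (Nat.le_of_dvd (Nat.gcd_pos_of_pos_left _ hx0) (Nat.dvd_gcd hpx hpN))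
  · exact lt_of_le_of_lt (Nat.le_of_dvd hx0 (Nat.gcd_dvd_left _ _)) hxN

/-- `∑_{b=1}^{n} 1/√b ≤ 2√n` (by induction, `1/√(n+1) ≤ 2(√(n+1) − √n)`); used in the estimate
of the number `s` of triples in the proof of Prop. 4.2. [folklore] -/
theorem sum_Icc_one_div_sqrt_le (n : ℕ) :
    ∑ b ∈ Finset.Icc 1 n, 1 / Real.sqrt b ≤ 2 * Real.sqrt n := by
  induction n with
  | zero => simp
  | succ n ih =>
    rw [Finset.sum_Icc_succ_top (by omega : 1 ≤ n + 1)]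
    have hs : 0 < Real.sqrt ((n + 1 : ℕ) : ℝ) := Real.sqrt_pos.2 (by positivity)
    have hprod : Real.sqrt n * Real.sqrt ((n + 1 : ℕ) : ℝ) ≤ n + 1 / 2 := by
      rw [← Real.sqrt_mul (Nat.cast_nonneg n)]
      refine Real.sqrt_le_iff.2 ⟨by positivity, ?_⟩
      push_cast
      nlinarith
    have hsq : Real.sqrt ((n + 1 : ℕ) : ℝ) * Real.sqrt ((n + 1 : ℕ) : ℝ) = n + 1 := by
      rw [Real.mul_self_sqrt (by positivity)]
      push_cast
      ring
    have key :
        1 / Real.sqrt ((n + 1 : ℕ) : ℝ) ≤ 2 * Real.sqrt ((n + 1 : ℕ) : ℝ) - 2 * Real.sqrt n := by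
      rw [div_le_iff₀ hs]
      nlinarith [hsq, hprod]
    linarith

/-- `∑_{a=1}^{r} ⌊r/a⌋ ≤ r (1 + log r)`: the number of pairs of positive integers `(a, b)` with
`ab ≤ r` is `O(r lg r)` ("The number of pairs `(a,b)` examined in Step (2) is `O(r lg r)`", proof of
Prop. 4.2). [folklore] -/
theorem sum_Icc_div_le (r : ℕ) :
    ∑ a ∈ Finset.Icc 1 r, ((r / a : ℕ) : ℝ) ≤ r * (1 + Real.log r) := by
  have hharm : ∑ a ∈ Finset.Icc 1 r, 1 / (a : ℝ) ≤ 1 + Real.log r := by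
    -- the harmonic bound `H_r ≤ 1 + log r` (Mathlib's `harmonic_le_one_add_log`; in the tree
    -- also `Literature.NumberTheory.LFunctions.Montgomery.sum_Icc_one_div_le_log`, not imported)
    have h := harmonic_le_one_add_log r
    have hcast : ((harmonic r : ℚ) : ℝ) = ∑ a ∈ Finset.Icc 1 r, 1 / (a : ℝ) := by
      rw [harmonic_eq_sum_Icc, Rat.cast_sum]
      refine Finset.sum_congr rfl fun a _ => ?_
      simp
    linarith [hcast]
  calc ∑ a ∈ Finset.Icc 1 r, ((r / a : ℕ) : ℝ) ≤ ∑ a ∈ Finset.Icc 1 r, (r : ℝ) * (1 / a) := by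
        refine Finset.sum_le_sum fun a _ => ?_
        rw [mul_one_div]
        exact Nat.cast_div_le
    _ = r * ∑ a ∈ Finset.Icc 1 r, 1 / (a : ℝ) := by rw [Finset.mul_sum]
    _ ≤ r * (1 + Real.log r) :=
        mul_le_mul_of_nonneg_left hharm (Nat.cast_nonneg r)

/-- `∑_{a=1}^{r} ∑_{b=1}^{⌊r/a⌋} 1/√(ab) ≤ 2√r (1 + log r)` — the double sum in the estimate of `s`
in the proof of Prop. 4.2 (inner sum `≤ 2(r/a)^{1/2}`, so the `a`-th term is `≤ 2√r/a`, then the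
harmonic bound). [folklore] -/
theorem sum_sum_one_div_sqrt_mul_le (r : ℕ) :
    ∑ a ∈ Finset.Icc 1 r, ∑ b ∈ Finset.Icc 1 (r / a), 1 / Real.sqrt ((a : ℝ) * b)
      ≤ 2 * Real.sqrt r * (1 + Real.log r) := by
  have hr0 : (0 : ℝ) ≤ r := Nat.cast_nonneg r
  have hharm : ∑ a ∈ Finset.Icc 1 r, 1 / (a : ℝ) ≤ 1 + Real.log r := by
    -- the harmonic bound `H_r ≤ 1 + log r` (Mathlib's `harmonic_le_one_add_log`; in the tree
    -- also `Literature.NumberTheory.LFunctions.Montgomery.sum_Icc_one_div_le_log`, not imported)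
    have h := harmonic_le_one_add_log r
    have hcast : ((harmonic r : ℚ) : ℝ) = ∑ a ∈ Finset.Icc 1 r, 1 / (a : ℝ) := by
      rw [harmonic_eq_sum_Icc, Rat.cast_sum]
      refine Finset.sum_congr rfl fun a _ => ?_
      simp
    linarith [hcast]
  calc ∑ a ∈ Finset.Icc 1 r, ∑ b ∈ Finset.Icc 1 (r / a), 1 / Real.sqrt ((a : ℝ) * b)
      ≤ ∑ a ∈ Finset.Icc 1 r, 2 * Real.sqrt r * (1 / (a : ℝ)) := by
        refine Finset.sum_le_sum fun a ha => ?_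
        have ha1 : (1 : ℝ) ≤ a := by exact_mod_cast (Finset.mem_Icc.1 ha).1
        have ha0 : (0 : ℝ) < a := by linarith
        have hsa : 0 < Real.sqrt a := Real.sqrt_pos.2 ha0
        have hsplit : ∀ b ∈ Finset.Icc 1 (r / a),
            1 / Real.sqrt ((a : ℝ) * b) = (1 / Real.sqrt a) * (1 / Real.sqrt b) := by
          intro b _
          rw [Real.sqrt_mul ha0.le, one_div_mul_one_div]
        rw [Finset.sum_congr rfl hsplit, ← Finset.mul_sum]
        calc 1 / Real.sqrt a * ∑ b ∈ Finset.Icc 1 (r / a), 1 / Real.sqrt b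
            ≤ 1 / Real.sqrt a * (2 * Real.sqrt ((r / a : ℕ) : ℝ)) :=
              mul_le_mul_of_nonneg_left (sum_Icc_one_div_sqrt_le _) (by positivity)
          _ ≤ 1 / Real.sqrt a * (2 * Real.sqrt ((r : ℝ) / a)) := by
              gcongr
              exact Nat.cast_div_le
          _ = 2 * Real.sqrt r * (1 / (a : ℝ)) := by
              rw [Real.sqrt_div hr0]
              field_simp
              rw [Real.sq_sqrt ha0.le]
              ring
    _ = 2 * Real.sqrt r * ∑ a ∈ Finset.Icc 1 r, 1 / (a : ℝ) := by rw [Finset.mul_sum]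
    _ ≤ 2 * Real.sqrt r * (1 + Real.log r) :=
        mul_le_mul_of_nonneg_left hharm (by positivity)

/-- **The number of giant steps** (proof of **Prop. 4.2** = arXiv Prop. 15, the estimate for `s`):
Step (2) of Algorithm 2 examines, for each pair `a, b ≥ 1` with `ab ≤ r`, the integers
`0 ≤ j < X/(ab)^{1/2}` with `X = N^{1/2}/(4rm)`, hence at most `∑_{1 ≤ ab ≤ r} (X/(ab)^{1/2} + 1)`
triples; this sum is at most `(2X√r + r)(1 + log r)`, i.e.
`s = O((N^{1/2}/(r^{1/2} m) + r) lg N)` for `r = O(N)` as printed (the pairs being enumerated as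
`a ∈ [1, r]`, `b ∈ [1, ⌊r/a⌋]`). [cite: Harvey2021, proof of Prop. 4.2 (arXiv Prop. 15)] -/
theorem candidate_count_le (r : ℕ) {X : ℝ} (hX : 0 ≤ X) :
    ∑ a ∈ Finset.Icc 1 r, ∑ b ∈ Finset.Icc 1 (r / a), (X / Real.sqrt ((a : ℝ) * b) + 1)
      ≤ (2 * X * Real.sqrt r + r) * (1 + Real.log r) := by
  have h1 := sum_sum_one_div_sqrt_mul_le r
  have h2 := sum_Icc_div_le r
  have hsplit : ∑ a ∈ Finset.Icc 1 r, ∑ b ∈ Finset.Icc 1 (r / a), (X / Real.sqrt ((a : ℝ) * b) + 1)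
      = X * ∑ a ∈ Finset.Icc 1 r, ∑ b ∈ Finset.Icc 1 (r / a), 1 / Real.sqrt ((a : ℝ) * b)
        + ∑ a ∈ Finset.Icc 1 r, ((r / a : ℕ) : ℝ) := by
    rw [Finset.mul_sum, ← Finset.sum_add_distrib]
    refine Finset.sum_congr rfl fun a _ => ?_
    rw [Finset.sum_add_distrib, Finset.sum_const, Nat.card_Icc, Nat.add_sub_cancel, nsmul_eq_mul,
      mul_one, Finset.mul_sum]
    congr 1
    exact Finset.sum_congr rfl fun b _ => (mul_one_div X _).symm
  rw [hsplit]
  refine (add_le_add (mul_le_mul_of_nonneg_left h1 hX) h2).trans_eq ?_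
  ring

end Harvey2021

end Literature.Computability.Cryptography
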